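import Literature.Topology.FourManifolds.FoldChartSigPoint
import HarnessLib

/-!
# Near a fold point every critical point is a fold point; regular points are stable

Topic `Literature/Topology/FourManifolds` (programme of the fact
`Literature.Topology.FourManifolds.exists_isSimplifiedBrokenLefschetzFibration`, Baykur–Saeki 2017, §2.1:
the fold locus of a generic map is a union of circles, the cusps are finitely many).  Two
openness statements used to count the cusps of a generic map:

* `eventually_surjective_fderiv` — if `dG_y` is onto then so is `dG_z` for `z` near `y`
  (a right inverse `R`, `dG_z ∘ R` stays invertible since the units of `ℝ² →L ℝ²` are open);
* `eventually_fderiv_ne_zero` — `dG ≠ 0` is an open condition;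
* `HasFoldChartSig.eventually_isFoldPointAt` — in a fold chart `(t, s₁x² + s₂y² + s₃z²)`,
  `sᵢ ≠ 0`, every critical point is a fold point (`OneJet.IsFoldPointAt`), hence every
  critical point of `F` near a point with a fold chart is a fold point.

Everything is proved; the fold model function `foldModelFn` and its differential `foldModelL`
are the only definitions; no named facts (D-0026).

## References

* M. Golubitsky, V. Guillemin, *Stable Mappings and Their Singularities*, GTM 14 (1973), Ch. III
  §4 (submersions with folds: the fold locus is a submanifold of fold points). [GolubitskyGuillemin1973]
* R. İ. Baykur, O. Saeki, *Simplifying indefinite fibrations on 4-manifolds*, arXiv:1705.11169,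
  §2.1, p. 6. [BaykurSaeki2017]
-/

noncomputable section

set_option maxSynthPendingDepth 2

open Set Function Filter Module
open scoped ContDiff Topology

namespace Literature.Topology.FourManifolds

/-- Local notation: `𝔼 n` is the model Euclidean space `EuclideanSpace ℝ (Fin n)`. -/
local notation "𝔼 " n:arg => EuclideanSpace ℝ (Fin n)

/-- Local notation: the coordinate covectors of `ℝ⁴`. -/
local notation "π₄" => (EuclideanSpace.proj (𝕜 := ℝ) (ι := Fin 4))

/-! ### Regular points are stable -/

/-- **Submersivity is an open condition**: if `dG_y : ℝ⁴ → ℝ²` is onto for a `C¹` map `G`, then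
`dG_z` is onto for all `z` near `y`. [folklore] -/
theorem eventually_surjective_fderiv {G : 𝔼 4 → 𝔼 2} {n : WithTop ℕ∞} (hG : ContDiff ℝ n G)
    (hn : n ≠ 0) {y : 𝔼 4} (hy : Surjective (fderiv ℝ G y)) :
    ∀ᶠ z in 𝓝 y, Surjective (fderiv ℝ G z) := by
  -- a right inverse of `dG_y`
  obtain ⟨R₀, hR₀⟩ := (fderiv ℝ G y : 𝔼 4 →ₗ[ℝ] 𝔼 2).exists_rightInverse_of_surjective
    (LinearMap.range_eq_top.2 hy)
  set R : 𝔼 2 →L[ℝ] 𝔼 4 := LinearMap.toContinuousLinearMap R₀ with hR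
  have hRid : (fderiv ℝ G y).comp R = 1 := by
    ext1 w
    have := congrArg (fun T : 𝔼 2 →ₗ[ℝ] 𝔼 2 => T w) hR₀
    simpa [hR] using this
  -- `z ↦ dG_z ∘ R` is continuous with invertible value at `y`
  have hcont : Continuous fun z => (fderiv ℝ G z).comp R :=
    (hG.continuous_fderiv hn).clm_comp continuous_const
  have hopen : IsOpen {T : 𝔼 2 →L[ℝ] 𝔼 2 | IsUnit T} := Units.isOpen
  have hyU : IsUnit ((fderiv ℝ G y).comp R) := by
    rw [hRid]
    exact isUnit_one
  filter_upwards [hcont.continuousAt.eventually (hopen.mem_nhds hyU)] with z hz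
  obtain ⟨u, hu⟩ := hz
  intro w
  refine ⟨R ((↑u⁻¹ : 𝔼 2 →L[ℝ] 𝔼 2) w), ?_⟩
  have h1 : ((fderiv ℝ G z).comp R) ((↑u⁻¹ : 𝔼 2 →L[ℝ] 𝔼 2) w) = w := by
    rw [← hu]
    show ((u : 𝔼 2 →L[ℝ] 𝔼 2) * (↑u⁻¹ : 𝔼 2 →L[ℝ] 𝔼 2)) w = w
    rw [Units.mul_inv, one_apply_eq_self]
  exact h1

/-- **`dG ≠ 0` is an open condition** for a `C¹` map. [folklore] -/
theorem eventually_fderiv_ne_zero {G : 𝔼 4 → 𝔼 2} {n : WithTop ℕ∞} (hG : ContDiff ℝ n G)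
    (hn : n ≠ 0) {y : 𝔼 4} (hy : fderiv ℝ G y ≠ 0) : ∀ᶠ z in 𝓝 y, fderiv ℝ G z ≠ 0 :=
  (hG.continuous_fderiv hn).continuousAt.eventually (isOpen_ne.mem_nhds hy)

/-! ### The fold model `(t, s₁x² + s₂y² + s₃z²)` -/

/-- The fold model function `y ↦ s₁ y₁² + s₂ y₂² + s₃ y₃²`. [cite: BaykurSaeki2017, §2.1] -/
def foldModelFn (s₁ s₂ s₃ : ℝ) (y : 𝔼 4) : ℝ := s₁ * y 1 ^ 2 + s₂ * y 2 ^ 2 + s₃ * y 3 ^ 2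

/-- Its differential `y ↦ 2s₁y₁ e₁* + 2s₂y₂ e₂* + 2s₃y₃ e₃*`, linear in `y`. [folklore] -/
def foldModelL (s₁ s₂ s₃ : ℝ) : 𝔼 4 →L[ℝ] (𝔼 4 →L[ℝ] ℝ) :=
  (π₄ 1).smulRight ((2 * s₁) • π₄ 1) + (π₄ 2).smulRight ((2 * s₂) • π₄ 2) +
    (π₄ 3).smulRight ((2 * s₃) • π₄ 3)

/-- `foldModelL y v = 2s₁y₁v₁ + 2s₂y₂v₂ + 2s₃y₃v₃`. [folklore] -/
@[simp]
theorem foldModelL_apply (s₁ s₂ s₃ : ℝ) (y v : 𝔼 4) :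
    foldModelL s₁ s₂ s₃ y v = 2 * s₁ * y 1 * v 1 + 2 * s₂ * y 2 * v 2 + 2 * s₃ * y 3 * v 3 := by
  simp [foldModelL]
  ring

/-- The differential of the fold model function. [folklore] -/
theorem hasFDerivAt_foldModelFn (s₁ s₂ s₃ : ℝ) (y : 𝔼 4) :
    HasFDerivAt (foldModelFn s₁ s₂ s₃) (foldModelL s₁ s₂ s₃ y) y := by
  have h1 : HasFDerivAt (fun y : 𝔼 4 => y 1 ^ 2) ((2 • y 1 ^ 1) • π₄ 1) y := (π₄ 1).hasFDerivAt.pow 2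
  have h2 : HasFDerivAt (fun y : 𝔼 4 => y 2 ^ 2) ((2 • y 2 ^ 1) • π₄ 2) y := (π₄ 2).hasFDerivAt.pow 2
  have h3 : HasFDerivAt (fun y : 𝔼 4 => y 3 ^ 2) ((2 • y 3 ^ 1) • π₄ 3) y := (π₄ 3).hasFDerivAt.pow 2
  refine (((h1.const_mul s₁).add (h2.const_mul s₂)).add (h3.const_mul s₃)).congr_fderiv ?_
  ext v
  simp
  ring

/-- `d(foldModelFn) = foldModelL`. [folklore] -/
theorem fderiv_foldModelFn (s₁ s₂ s₃ : ℝ) :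
    fderiv ℝ (foldModelFn s₁ s₂ s₃) = fun y => foldModelL s₁ s₂ s₃ y :=
  funext fun y => (hasFDerivAt_foldModelFn s₁ s₂ s₃ y).fderiv

/-- `D²(foldModelFn)_y = foldModelL` (constant). [folklore] -/
theorem fderiv_fderiv_foldModelFn (s₁ s₂ s₃ : ℝ) (y : 𝔼 4) :
    fderiv ℝ (fderiv ℝ (foldModelFn s₁ s₂ s₃)) y = foldModelL s₁ s₂ s₃ := by
  rw [fderiv_foldModelFn]
  exact (foldModelL s₁ s₂ s₃).fderiv

/-- The fold model function is `C^∞`. [folklore] -/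
theorem contDiff_foldModelFn (s₁ s₂ s₃ : ℝ) : ContDiff ℝ ∞ (foldModelFn s₁ s₂ s₃) :=
  ((contDiff_const.mul ((π₄ 1).contDiff.pow 2)).add (contDiff_const.mul ((π₄ 2).contDiff.pow 2))).add
    (contDiff_const.mul ((π₄ 3).contDiff.pow 2))

/-- **Every critical point of the fold model is a fold point** (`sᵢ ≠ 0`): the kernel Hessian
is `diag(2s₁, 2s₂, 2s₃)`. [cite: GolubitskyGuillemin1973, Ch. III §4] -/
theorem isFoldPointAt_foldModel {s₁ s₂ s₃ : ℝ} (hs₁ : s₁ ≠ 0) (hs₂ : s₂ ≠ 0) (hs₃ : s₃ ≠ 0)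
    {y : 𝔼 4} (hcrit : ¬ Surjective (fderiv ℝ (OneJet.rankOneMap (foldModelFn s₁ s₂ s₃)) y)) :
    OneJet.IsFoldPointAt (OneJet.rankOneMap (foldModelFn s₁ s₂ s₃)) y := by
  have hfd : DifferentiableAt ℝ (foldModelFn s₁ s₂ s₃) y :=
    (hasFDerivAt_foldModelFn s₁ s₂ s₃ y).differentiableAt
  rw [OneJet.isFoldPointAt_rankOneMap_iff isOpen_univ (contDiff_foldModelFn s₁ s₂ s₃).contDiffOn
    (mem_univ y)]
  refine ⟨(OneJet.not_surjective_fderiv_rankOneMap_iff hfd).1 hcrit, fun k₀ hk₀ hrad => ?_⟩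
  have h1 := hrad (EuclideanSpace.single (1 : Fin 4) (1 : ℝ)) (by simp)
  have h2 := hrad (EuclideanSpace.single (2 : Fin 4) (1 : ℝ)) (by simp)
  have h3 := hrad (EuclideanSpace.single (3 : Fin 4) (1 : ℝ)) (by simp)
  rw [fderiv_fderiv_foldModelFn] at h1 h2 h3
  simp only [foldModelL_apply] at h1 h2 h3
  simp at h1 h2 h3
  have hk1 : k₀ 1 = 0 := by
    rcases h1 with h | h
    · exact absurd h hs₁
    · exact h
  have hk2 : k₀ 2 = 0 := by
    rcases h2 with h | h
    · exact absurd h hs₂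
    · exact h
  have hk3 : k₀ 3 = 0 := by
    rcases h3 with h | h
    · exact absurd h hs₃
    · exact h
  ext i
  fin_cases i
  · simpa using hk₀
  · simpa using hk1
  · simpa using hk2
  · simpa using hk3

/-! ### Transfer to a map with a fold chart -/

/-- Surjectivity of `B ∘ D ∘ A` for invertible `A`, `B`. [folklore] -/
private theorem surjective_equiv_comp_iff' {E₁ E₂ F₁ F₂ : Type*} [NormedAddCommGroup E₁]
    [NormedSpace ℝ E₁] [NormedAddCommGroup E₂] [NormedSpace ℝ E₂] [NormedAddCommGroup F₁]
    [NormedSpace ℝ F₁] [NormedAddCommGroup F₂] [NormedSpace ℝ F₂] (A : E₁ ≃L[ℝ] E₂)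
    (B : F₂ ≃L[ℝ] F₁) (D : E₂ →L[ℝ] F₂) :
    Surjective ((B : F₂ →L[ℝ] F₁).comp (D.comp (A : E₁ →L[ℝ] E₂))) ↔ Surjective D := by
  constructor
  · intro hs
    have h1 : Surjective (⇑B ∘ (⇑D ∘ ⇑A)) := hs
    exact (h1.of_comp_left B.injective).of_comp
  · intro hD
    exact B.surjective.comp (hD.comp A.surjective)

/-- `2 ≤ ∞` in `WithTop ℕ∞`. [folklore] -/
private theorem two_le_infty₈ : (2 : WithTop ℕ∞) ≤ ∞ := WithTop.coe_le_coe.2 le_top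

/-- **Near a point with a fold chart, every critical point is a fold point** (`sᵢ ≠ 0`).
[cite: GolubitskyGuillemin1973, Ch. III §4] [cite: BaykurSaeki2017, §2.1, p. 6] -/
theorem HasFoldChartSig.eventually_isFoldPointAt {F : 𝔼 4 → 𝔼 2} {p : 𝔼 4} {s₁ s₂ s₃ : ℝ}
    (hch : HasFoldChartSig F p s₁ s₂ s₃) (hs₁ : s₁ ≠ 0) (hs₂ : s₂ ≠ 0) (hs₃ : s₃ ≠ 0) :
    ∀ᶠ q in 𝓝 p, ¬ Surjective (fderiv ℝ F q) → OneJet.IsFoldPointAt F q := by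
  obtain ⟨φ, ψ, hpφ, hp0, hmaps, hφ, hφs, hψ, hψs, hid⟩ := hch
  set G : 𝔼 4 → 𝔼 2 := OneJet.rankOneMap (foldModelFn s₁ s₂ s₃) with hG
  have hGs : ContDiff ℝ ∞ G := by
    have h := OneJet.contDiffOn_rankOneMap (contDiff_foldModelFn s₁ s₂ s₃).contDiffOn (Ω := univ)
    exact contDiffOn_univ.1 h
  -- the chart identity as an identity of vectors, and `F = ψ⁻¹ ∘ G ∘ φ` on `φ.source`
  have hidv : ∀ q ∈ φ.source, ψ (F q) = G (φ q) := by
    intro q hq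
    obtain ⟨h0', h1'⟩ := hid q hq
    ext i
    fin_cases i
    · show ψ (F q) 0 = OneJet.rankOneMap _ (φ q) 0
      rw [OneJet.rankOneMap_apply_zero, h0']
    · show ψ (F q) 1 = OneJet.rankOneMap _ (φ q) 1
      rw [OneJet.rankOneMap_apply_one, h1']
      rfl
  have hev : ∀ q ∈ φ.source, F =ᶠ[𝓝 q] (ψ.symm ∘ G) ∘ φ := by
    intro q hq
    filter_upwards [φ.open_source.mem_nhds hq] with q' hq'
    show F q' = ψ.symm (G (φ q'))
    rw [← hidv q' hq', ψ.left_inv (hmaps hq')]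
  have htransfer : ∀ q ∈ φ.source,
      (Surjective (fderiv ℝ F q) ↔ Surjective (fderiv ℝ G (φ q))) ∧
        (OneJet.IsFoldPointAt F q ↔ OneJet.IsFoldPointAt G (φ q)) := by
    intro q hq
    obtain ⟨A, hA, -⟩ := exists_fderiv_continuousLinearEquiv φ hφ hφs (by simp) hq
    have hFq : F q ∈ ψ.source := hmaps hq
    obtain ⟨B, -, hBs⟩ := exists_fderiv_continuousLinearEquiv ψ hψ hψs (by simp) hFq
    have hGq : G (φ q) = ψ (F q) := (hidv q hq).symm
    have hBs' : HasFDerivAt ψ.symm (B.symm : 𝔼 2 →L[ℝ] 𝔼 2) (G (φ q)) := by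
      rw [hGq]
      exact hBs
    have hφ2 : ContDiffAt ℝ 2 φ q := (hφ.contDiffAt (φ.open_source.mem_nhds hq)).of_le two_le_infty₈
    have hG2 : ContDiffAt ℝ 2 G (φ q) := hGs.contDiffAt.of_le two_le_infty₈
    have hψs2 : ContDiffAt ℝ 2 ψ.symm (G (φ q)) := by
      rw [hGq]
      exact (hψs.contDiffAt (ψ.open_target.mem_nhds (ψ.map_source hFq))).of_le two_le_infty₈
    have hψG2 : ContDiffAt ℝ 2 (ψ.symm ∘ G) (φ q) := hψs2.comp (φ q) hG2
    have hGd : HasFDerivAt G (fderiv ℝ G (φ q)) (φ q) :=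
      (hGs.differentiable (by simp) _).hasFDerivAt
    have hFd : HasFDerivAt F ((B.symm : 𝔼 2 →L[ℝ] 𝔼 2).comp ((fderiv ℝ G (φ q)).comp
        (A : 𝔼 4 →L[ℝ] 𝔼 4))) q :=
      ((hBs'.comp (φ q) hGd).comp q hA).congr_of_eventuallyEq (hev q hq)
    refine ⟨?_, ?_⟩
    · rw [hFd.fderiv]
      exact surjective_equiv_comp_iff' A B.symm (fderiv ℝ G (φ q))
    · rw [OneJet.isFoldPointAt_congr_of_eventuallyEq (hev q hq),
        OneJet.isFoldPointAt_comp_iff A hA hφ2 hψG2,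
        OneJet.isFoldPointAt_comp_target_iff B.symm hBs' hψs2 hG2]
  filter_upwards [φ.open_source.mem_nhds hpφ] with q hqs hcrit
  have hcritG : ¬ Surjective (fderiv ℝ G (φ q)) := by rwa [← (htransfer q hqs).1]
  exact (htransfer q hqs).2.2 (isFoldPointAt_foldModel hs₁ hs₂ hs₃ hcritG)

end Literature.Topology.FourManifolds
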